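import Summits.BirchSwinnertonDyer.BirchSwinnertonDyer.Theorems.SylvesterTwoHeegnerIndexLowerHalfFourTorsionMembers
import HarnessLib

/-!
# Route `SylvesterTwoHeegnerIndex` (rung K7t), LOWER children of crux 19477 (`LowerOffV0HSY`, item 19892):
# per-member consumers for the NEW row type `Ш(E_p)[2] ≅ (ℤ/2)⁴` (`dim_𝔽₂ Sel₂(E_p/ℚ) = 5`)
# (helper toward stmt-BirchSwinnertonDyer-19892; cell «bsd-cm», seat `bsd-cm-k7t-c3` g7; theorems only)

HONEST FRAMING (cell «bsd-cm», `run/shared/lean/pub/bsd-cm/`; FULL-BSD RANK ≤ 1 programme): the class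
𝒞_HSY at `p = 2` (B14 / O12: `BSD(E_p, 2)` for the Sylvester curves `E_p : x³ + y³ = p`,
`p ≡ 4, 7 (mod 9)` prime, `3 ∉ 𝔽_p^{×3}`) is OPEN in print and stays open here. THEOREMS ONLY
(0 definitions, 0 named facts, 0 `sorry`). Every member conclusion is CONDITIONAL on its displayed
hypotheses: the route's support item `PublishedFactsTwo` and, at a member, DISPLAYED PER-CURVE
CERTIFICATE DATA that are NOT proved in the kernel (the analytic order `#Ш_an(E_p) = q` and `2`-descent
data on `Ш(E_p)`).

## What is new in this file

The sibling files (`…LowerHalfCertificates`, `…LowerHalfFourTorsionMembers{,B,C,D}`) grade the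
LOWER inequality `ord₂ #Ш_an(E_p) ≤ ord₂ #Ш(E_p)` by the `2`-descent datum on `Ш(E_p)` for the two
row types met up to `p ≤ 4·10⁵` (`Ш[2] ≅ (ℤ/2)²`; `(ℤ/4)² ↪ Ш`). The seat-g7 census to `10⁷`
(kit j269192 / j269338, PARI `ellrank` + `bnfinit` on all 140 068 members `4·10⁵ < p ≤ 10⁷`; memo
`HOME/bsd-cm-k7t-c3/g7/U2-LANE-k7t-c3-g7.md`) found a THIRD row type: **78 members with
`dim_𝔽₂ Sel₂(E_p/ℚ) = 5`, i.e. `Ш(E_p)[2] ≅ (ℤ/2)⁴`** (first seven `bnfcertify`'d, kit j269295).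
On those of `ellrank` type `[1, 1, 4]` the Cassels–Tate pairing on `Sel₂` has rank `4 = dim Ш[2]`,
so **`Ш(E_p)[4] = Ш(E_p)[2]`**, and then the descent pins the whole `2`-primary part:
`Ш(E_p)[2^∞] = Ш(E_p)[2] ≅ (ℤ/2)⁴` (§1, `primaryComponent_eq_torsionBy_of_sq`). At such a member
BOTH halves of `BSD(E_p, 2)` reduce to the one numerical identity `ord₂ #Ш_an(E_p) = 4`
(§2, `bsdTwo_member_of_twoRankFour_cert`); the LOWER half alone needs only `2ⁿ ∣ #Ш(E_p)[2]`
(`lower_member_of_twoTorsion_cert`). §3: the six certified `[1,1,4]` members `p ≤ 2·10⁶` as rows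
(single-engine `#Ш_an = 16`, kit j269511, displayed as the HYPOTHESIS `hq`, as in the sibling files).

PARTITION (D-0054): CornerF at `2` / O12 × 𝒞_HSY members with `dim Ш(E_p)[2] = 4` (per member)
× `p = 2` — per-pair certificate consumers; closes no cell and no class; nothing booked. NOT a
proof of the crux, of `BSD(E_p, 2)` for any `p` as an unconditional kernel theorem, or of any cell.
References (locators only): [HuShuYin2019] Thm. 1.3/1.4 (p. 3); [BurungaleFlach2024] Thm. 1.1,
Cor. 2; [Miller2011LMS] §1, Def. 1.1; [Cremona1997] §3.6; Cassels, J.W.S., "Arithmetic on curves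
of genus 1. IV. Proof of the Hauptvermutung", J. reine angew. Math. 211 (1962) 95–112 (the pairing;
its kernel on `Ш[2]` is `Ш[2] ∩ 2Ш`); [KezukaLi2020] Thm. 1.3; Eisenbeis–Frey–Ommerborn,
Math. Comp. 32 (1978) 559–569 (2-ranks of pure cubic fields, Tables 1–4).
-/

set_option autoImplicit false
-- the Theorems namespace `Summit.BirchSwinnertonDyer.BirchSwinnertonDyer.…` repeats a component by design (D-0017 layout)
set_option linter.dupNamespace false

noncomputable section

open scoped Classical

open WeierstrassCurve NumberField Literature.NumberTheory.EllipticCurves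
  Literature.NumberTheory.EllipticCurves.ModularForms
  Literature.NumberTheory.EllipticCurves.Rank1Residual
  Literature.NumberTheory.EllipticCurves.Rank1Residual.Typed
  Literature.NumberTheory.EllipticCurves.HuShuYin2019
  Summit.BirchSwinnertonDyer.Rank1Residual.P2
  Summit.BirchSwinnertonDyer.Rank1Residual.X12.Sylvester
  Summit.BirchSwinnertonDyer.BirchSwinnertonDyer.Theses.SylvesterTwoHeegnerIndex

namespace Summit.BirchSwinnertonDyer.BirchSwinnertonDyer.Theorems

namespace SylvesterTwoLowerCert

/-! ## §1 Groups in which `p²`-torsion is `p`-torsion -/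

section PrimaryOfSq

variable {A : Type*} [AddCommGroup A] {p : ℕ}

/-- If every element killed by `p·p` is killed by `p`, then every element killed by a power of `p` is
killed by `p` (induction on the exponent). [folklore] -/
theorem nsmul_eq_zero_of_pow_nsmul_eq_zero (h : ∀ a : A, (p * p) • a = 0 → p • a = 0) :
    ∀ (k : ℕ) (a : A), p ^ k • a = 0 → p • a = 0 := by
  intro k
  induction k with
  | zero =>
    intro a ha
    rw [pow_zero, one_smul] at ha
    rw [ha, smul_zero]
  | succ k ih =>
    intro a ha
    rw [pow_succ, ← smul_smul] at ha
    -- `p ^ k • (p • a) = 0`, so `p • (p • a) = 0` by induction, i.e. `(p * p) • a = 0`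
    have h2 : (p * p) • a = 0 := by
      rw [← smul_smul]
      exact ih (p • a) ha
    exact h a h2

/-- **A group whose `p²`-torsion is `p`-torsion has `p`-primary part EQUAL to its `p`-torsion.**
(For `Ш(E)`: `Ш[4] = Ш[2]` — e.g. when the Cassels–Tate pairing on `Ш[2]` is non-degenerate —
forces `Ш[2^∞] = Ш[2]`.) [folklore] -/
theorem primaryComponent_eq_torsionBy_of_sq [Fact p.Prime]
    (h : ∀ a : A, (p * p) • a = 0 → p • a = 0) :
    AddCommGroup.primaryComponent A p = AddSubgroup.torsionBy A p := by
  ext a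
  rw [AddCommGroup.mem_primaryComponent, AddSubgroup.torsionBy.nsmul_iff]
  constructor
  · rintro ⟨k, hk⟩
    exact nsmul_eq_zero_of_pow_nsmul_eq_zero h k a hk
  · intro ha
    exact ⟨1, by rw [pow_one, ha]⟩

/-- Cardinality form of `primaryComponent_eq_torsionBy_of_sq`: `#A(p) = #A[p]`. [folklore] -/
theorem natCard_primaryComponent_eq_of_sq [Fact p.Prime]
    (h : ∀ a : A, (p * p) • a = 0 → p • a = 0) :
    Nat.card (AddCommGroup.primaryComponent A p) = Nat.card (AddSubgroup.torsionBy A p) := by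
  rw [primaryComponent_eq_torsionBy_of_sq h]

/-- `ord₂ 16 = 4` in `ℕ`. [folklore] -/
theorem padicValNat_two_16 : padicValNat 2 16 = 4 := by
  rw [show (16 : ℕ) = 2 ^ 4 by norm_num, padicValNat.prime_pow]

end PrimaryOfSq

/-! ## §2 Member-generic consumers for the row type `dim Ш(E_p)[2] = 4` -/

section Consumers

variable {p : ℕ}

/-- **Member-generic LOWER consumer, `2`-torsion form.** At an 𝒞_HSY parameter `p`, from the route's
support item `PublishedFactsTwo` and two DISPLAYED per-curve certificates — `hq : #Ш_an(E_p) = q`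
with `ord₂ q ≤ n`, and `hT : 2ⁿ ∣ #Ш(E_p)[2]` (a `2`-descent exhibiting `n` independent classes of
order `2` in `Ш`; for the seat-g7 rows `n = 4`, `Ш(E_p)[2] ≅ (ℤ/2)⁴`) — the body of
`HeegnerIndexLowerAtTwoHSY` at `p` holds for EVERY global minimal model `W` of `E_p` and EVERY
Heegner frame: `ord₂ 𝔮 = ord₂ q ≤ n ≤ ord₂ #Ш(W)[2] ≤ ord₂ #Ш(W)`. CONDITIONAL; EVIDENCE consumer;
says nothing about other `p`. [cite: HuShuYin2019, Thm. 1.3 and Thm. 1.4 (p. 3)]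
[cite: BurungaleFlach2024, Thm. 1.1 and Cor. 2] [cite: Miller2011LMS, §1 and Def. 1.1]
[cite: Cremona1997, §3.6] -/
theorem lower_member_of_twoTorsion_cert
    (hsy : Nat.Prime p ∧ (p % 9 = 4 ∨ p % 9 = 7) ∧ ¬ ∃ x : ZMod p, x ^ 3 = 3)
    (hF : PublishedFactsTwo) {q : ℚ} {n : ℕ} (hv : padicValRat 2 q ≤ n)
    (hq : ∀ (W : WeierstrassCurve ℚ) [W.IsElliptic] [W.IsGloballyMinimal],
      (∃ C : VariableChange ℚ, C • W = cubeSumCurve (p : ℚ)) → shaAn W = (q : ℂ))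
    (hT : ∀ (W : WeierstrassCurve ℚ) [W.IsElliptic] [W.IsGloballyMinimal],
      (∃ C : VariableChange ℚ, C • W = cubeSumCurve (p : ℚ)) →
        2 ^ n ∣ Nat.card (AddSubgroup.torsionBy W.sha (2 : ℕ))) :
    ∀ (W : WeierstrassCurve ℚ) [W.IsElliptic] [W.IsGloballyMinimal],
      (∃ C : VariableChange ℚ, C • W = cubeSumCurve (p : ℚ)) →
      ∀ (N : ℕ) [NeZero N] (K : Type) [Field K] [NumberField K]
        (Dt : ModularParametrizationData W N) (H : HeegnerDatum N (NumberField.discr K)) (ι : K →+* ℂ)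
        (P : (W.baseChange K).toAffine.Point) (Wd : WeierstrassCurve ℚ) [Wd.IsElliptic]
        [Wd.IsGloballyMinimal] (Cd : VariableChange ℚ) (k : ℕ),
        W.HasCM → W.analyticRank = 1 → IsImaginaryQuadratic K → SatisfiesHeegnerHypothesis N K →
        WeierstrassCurve.Affine.Point.map ι.toRatAlgHom P = heegnerPointComplex Dt H →
        (W.quadraticTwist (NumberField.discr K : ℚ)).entireLFunction 1 ≠ 0 →
        Cd • W.quadraticTwist (NumberField.discr K : ℚ) = Wd → (k = 1 ∨ k = 2) →
        (k = 2 ↔ ∀ y : W.toAffine.Point, ∃ Q : (W.baseChange K).toAffine.Point,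
          QuadraticDescent.incl K W y - (2 : ℤ) • Q ∈ AddCommGroup.torsion (W.baseChange K).toAffine.Point) →
        padicValRat 2 (cmHeegnerIndexQuotient W K P Dt.c k Wd Cd.u) ≤
          padicValNat 2 (Nat.card W.sha) := by
  obtain ⟨hHSY, hBF, hmod, -, -, hGZ, hKo, hGZK, -, -, -⟩ := hF
  obtain ⟨hpr, h9, h3⟩ := hsy
  intro W _ _ hW N _ K _ _ Dt H ι P Wd _ _ Cd k _ _ hK hHN hP hLt hWd hk hkiff
  have hdvd : 2 ^ n ∣ Nat.card W.sha :=
    (hT W hW).trans (AddSubgroup.card_addSubgroup_dvd_card _)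
  exact lower_frame_of_shaAn_of_pow_dvd_card W hHSY hBF hmod hGZK hpr h9 h3 hW (hq W hW) hv hdvd
    N K Dt H ι P (hGZ N W K) (hKo N W K) hK hHN hP hLt Wd Cd hWd hk hkiff

/-- **At a member with `Ш(E_p)[4] = Ш(E_p)[2]` of order `16` and `ord₂ #Ш_an(E_p) = 4`, `BSD(E_p, 2)`
HOLDS** (granted `PublishedFactsTwo` and the displayed certificates): the `2`-descent datum
`hT` — `#Ш(W)[2] = 16` and every class killed by `4` is killed by `2` (the Cassels–Tate pairing on
`Sel₂` has rank `4`: PARI `ellrank` type `[1, 1, 4]`) — pins `Ш(W)[2^∞] = Ш(W)[2]`, so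
`ord₂ #Ш(W)[2^∞] = 4 = ord₂ q`. Both the LOWER and the UPPER half at once; CONDITIONAL; EVIDENCE
consumer. [cite: Miller2011LMS, §1 and Def. 1.1] [cite: HuShuYin2019, Thm. 1.3 and Thm. 1.4 (p. 3)]
[cite: BurungaleFlach2024, Thm. 1.1 and Cor. 2] -/
theorem bsdTwo_member_of_twoRankFour_cert
    (hsy : Nat.Prime p ∧ (p % 9 = 4 ∨ p % 9 = 7) ∧ ¬ ∃ x : ZMod p, x ^ 3 = 3)
    (hF : PublishedFactsTwo) {q : ℚ} (hv : padicValRat 2 q = 4)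
    (hq : ∀ (W : WeierstrassCurve ℚ) [W.IsElliptic] [W.IsGloballyMinimal],
      (∃ C : VariableChange ℚ, C • W = cubeSumCurve (p : ℚ)) → shaAn W = (q : ℂ))
    (hT : ∀ (W : WeierstrassCurve ℚ) [W.IsElliptic] [W.IsGloballyMinimal],
      (∃ C : VariableChange ℚ, C • W = cubeSumCurve (p : ℚ)) →
        Nat.card (AddSubgroup.torsionBy W.sha (2 : ℕ)) = 16 ∧
        ∀ z : W.sha, (2 * 2) • z = 0 → 2 • z = 0)
    (W : WeierstrassCurve ℚ) [W.IsElliptic] [W.IsGloballyMinimal]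
    (hW : ∃ C : VariableChange ℚ, C • W = cubeSumCurve (p : ℚ)) :
    BSDp W 2 := by
  haveI : Fact (Nat.Prime 2) := ⟨Nat.prime_two⟩
  obtain ⟨hHSY, hBF, hmod, -, -, -, -, hGZK, -, -, -⟩ := hF
  obtain ⟨hpr, h9, h3⟩ := hsy
  obtain ⟨hr, -, -⟩ :=
    Summit.BirchSwinnertonDyer.Rank1Residual.X12.CubeSumFamilies.bsdp_three_of_thm14' hHSY hBF hmod hpr h9 h3 W hW
  obtain ⟨h16, h42⟩ := hT W hW
  have hrank : W.mordellWeilRank = W.analyticRank := (hGZK W (by rw [hr])).1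
  have hprim : Nat.card (AddCommGroup.primaryComponent W.sha 2) = 16 := by
    rw [natCard_primaryComponent_eq_of_sq h42, h16]
  haveI : Finite (AddCommGroup.primaryComponent W.sha 2) :=
    Nat.finite_of_card_ne_zero (by rw [hprim]; norm_num)
  refine ⟨hrank, inferInstance, q, hq W hW, ?_⟩
  rw [hv, hprim, padicValNat_two_16]
  norm_num

/-- The same datum read for the LOWER crux alone (the form the route's item consumes): at such a member
the body of `HeegnerIndexLowerAtTwoHSY` at `p` holds in every frame. [cite: Miller2011LMS, §1 and Def. 1.1]
[cite: HuShuYin2019, Thm. 1.3 and Thm. 1.4 (p. 3)] -/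
theorem lower_member_of_twoRankFour_cert
    (hsy : Nat.Prime p ∧ (p % 9 = 4 ∨ p % 9 = 7) ∧ ¬ ∃ x : ZMod p, x ^ 3 = 3)
    (hF : PublishedFactsTwo) {q : ℚ} (hv : padicValRat 2 q = 4)
    (hq : ∀ (W : WeierstrassCurve ℚ) [W.IsElliptic] [W.IsGloballyMinimal],
      (∃ C : VariableChange ℚ, C • W = cubeSumCurve (p : ℚ)) → shaAn W = (q : ℂ))
    (hT : ∀ (W : WeierstrassCurve ℚ) [W.IsElliptic] [W.IsGloballyMinimal],
      (∃ C : VariableChange ℚ, C • W = cubeSumCurve (p : ℚ)) →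
        Nat.card (AddSubgroup.torsionBy W.sha (2 : ℕ)) = 16 ∧
        ∀ z : W.sha, (2 * 2) • z = 0 → 2 • z = 0) :
    ∀ (W : WeierstrassCurve ℚ) [W.IsElliptic] [W.IsGloballyMinimal],
      (∃ C : VariableChange ℚ, C • W = cubeSumCurve (p : ℚ)) →
      ∀ (N : ℕ) [NeZero N] (K : Type) [Field K] [NumberField K]
        (Dt : ModularParametrizationData W N) (H : HeegnerDatum N (NumberField.discr K)) (ι : K →+* ℂ)
        (P : (W.baseChange K).toAffine.Point) (Wd : WeierstrassCurve ℚ) [Wd.IsElliptic]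
        [Wd.IsGloballyMinimal] (Cd : VariableChange ℚ) (k : ℕ),
        W.HasCM → W.analyticRank = 1 → IsImaginaryQuadratic K → SatisfiesHeegnerHypothesis N K →
        WeierstrassCurve.Affine.Point.map ι.toRatAlgHom P = heegnerPointComplex Dt H →
        (W.quadraticTwist (NumberField.discr K : ℚ)).entireLFunction 1 ≠ 0 →
        Cd • W.quadraticTwist (NumberField.discr K : ℚ) = Wd → (k = 1 ∨ k = 2) →
        (k = 2 ↔ ∀ y : W.toAffine.Point, ∃ Q : (W.baseChange K).toAffine.Point,
          QuadraticDescent.incl K W y - (2 : ℤ) • Q ∈ AddCommGroup.torsion (W.baseChange K).toAffine.Point) →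
        padicValRat 2 (cmHeegnerIndexQuotient W K P Dt.c k Wd Cd.u) ≤
          padicValNat 2 (Nat.card W.sha) :=
  lower_member_of_twoTorsion_cert (n := 4) hsy hF (le_of_eq hv) hq
    (fun W _ _ hW => by rw [(hT W hW).1]; norm_num)

end Consumers

/-! ## §3 The six certified member rows `p ≤ 2·10⁶` with `Ш(E_p)[2] ≅ (ℤ/2)⁴` and `ellrank` type `[1,1,4]` (seat g7: 2-descent
census kit j269192, cubic fields `bnfcertify`'d kit j269295, single-engine analytic side kit j269511)

Reading key for the displayed certificates (HYPOTHESES, not kernel facts). `hq : #Ш_an(E_p) = 16`: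
PARI 2.17 `ellL1`/`ellbsd`/`ellheight` at 28 digits on the Sylvester model `[0,0,p,0,−7p²]`, generator
`G` = the `ellrank` point saturated at all primes `≤ 500`, `L′(E_p,1)/(Ω·∏c_v·ĥ(G)) = 16.000…`
(agreement `< 10⁻³⁶`; ONE engine — «numerically exact, NOT certified» in the cell's grading).
`hT : #Ш(E_p)[2] = 16 ∧ Ш(E_p)[4] = Ш(E_p)[2]`: PARI `ellrank` at efforts 0, 1, 2 returns `[1, 1, 4]`
(`dim Sel₂ = 5`, found rank `1`, Cassels–Tate pairing on `Sel₂` of rank `4`) on the `bnfcertify`'d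
cubic field `ℚ(∛4p)` (GRH-free); for `p ≡ 4 (9)` the cell's THEOREM A (`dim Sel₂ = k + [k even]`,
`k = rk₂ Cl(ℚ(∛4p))`, memo two §14.2) gives `dim Sel₂ = 5` from the class group independently.
-/

/-! ### `E_{562399} : x³ + y³ = 562399` (`p ≡ 7 (mod 9)`; conductor `9·562399² = 2846633716809`) -/

/-- `562399` is an 𝒞_HSY parameter: prime, `562399 ≡ 7 (mod 9)`, and `3` is not a cube mod `562399`
(Euler: `3^((562399−1)/3) ≢ 1 (mod 562399)`). [cite: HuShuYin2019, Thm. 1.4 (p. 3)] -/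
theorem hsy_562399 :
    Nat.Prime 562399 ∧ (562399 % 9 = 4 ∨ 562399 % 9 = 7) ∧ ¬ ∃ x : ZMod 562399, x ^ 3 = 3 :=
  hsy_of_pow_mod_ne_one (by norm_num) (Or.inr rfl) (by decide +kernel)

/-- **`BSD(E_{562399}, 2)` from `PublishedFactsTwo` + two DISPLAYED certificates NOT proved in the
kernel:** `hq : #Ш_an(E_{562399}) = 16` (kit j269511: `L′(E,1) = 8.4007577139…`, `∏c_v = 6`,
generator from `(1687197/49, 2037009178/343)`, `ĥ = 4.0886599…`) and `hT : #Ш(E_{562399})[2] = 16`,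
`Ш[4] = Ш[2]` (kit j269295: `ellrank = [1,1,4]` at efforts 0/1/2; `Cl(ℚ(∛(4·562399))) ≅ [12,2,2]`,
`bnfcertify = 1`). CONDITIONAL; EVIDENCE consumer; says nothing about other `p`.
[cite: Miller2011LMS, §1 and Def. 1.1] [cite: HuShuYin2019, Thm. 1.3 and Thm. 1.4 (p. 3)]
[cite: BurungaleFlach2024, Thm. 1.1 and Cor. 2] -/
theorem sylvesterTwoHeegnerIndex_bsdTwo_562399_of_cert (hF : PublishedFactsTwo)
    (hq : ∀ (W : WeierstrassCurve ℚ) [W.IsElliptic] [W.IsGloballyMinimal],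
      (∃ C : VariableChange ℚ, C • W = cubeSumCurve ((562399 : ℕ) : ℚ)) → shaAn W = ((16 : ℚ) : ℂ))
    (hT : ∀ (W : WeierstrassCurve ℚ) [W.IsElliptic] [W.IsGloballyMinimal],
      (∃ C : VariableChange ℚ, C • W = cubeSumCurve ((562399 : ℕ) : ℚ)) →
        Nat.card (AddSubgroup.torsionBy W.sha (2 : ℕ)) = 16 ∧
        ∀ z : W.sha, (2 * 2) • z = 0 → 2 • z = 0)
    (W : WeierstrassCurve ℚ) [W.IsElliptic] [W.IsGloballyMinimal]
    (hW : ∃ C : VariableChange ℚ, C • W = cubeSumCurve ((562399 : ℕ) : ℚ)) :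
    BSDp W 2 :=
  bsdTwo_member_of_twoRankFour_cert hsy_562399 hF padicValRat_two_16 hq hT W hW

/-! ### `E_{1113379}` (`p ≡ 7 (mod 9)`; conductor `9·1113379² = 11156515178769`) -/

/-- `1113379` is an 𝒞_HSY parameter: prime, `≡ 7 (mod 9)`, `3` not a cube mod it (Euler).
[cite: HuShuYin2019, Thm. 1.4 (p. 3)] -/
theorem hsy_1113379 :
    Nat.Prime 1113379 ∧ (1113379 % 9 = 4 ∨ 1113379 % 9 = 7) ∧ ¬ ∃ x : ZMod 1113379, x ^ 3 = 3 :=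
  hsy_of_pow_mod_ne_one (by norm_num) (Or.inr rfl) (by decide +kernel)

/-- **`BSD(E_{1113379}, 2)` from `PublishedFactsTwo` + DISPLAYED certificates** `hq : #Ш_an = 16`
(kit j269511: `L′(E,1) = 7.0770492487…`, `∏c_v = 6`, generator from `(3340137/64, 5637037877/512)`,
`ĥ = 4.3249481…`) and `hT` (kit j269295: `ellrank = [1,1,4]` ×3 efforts; `Cl(ℚ(∛(4·1113379))) ≅ [6,2,2]`,
`bnfcertify = 1`). CONDITIONAL; EVIDENCE consumer. [cite: Miller2011LMS, §1 and Def. 1.1]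
[cite: HuShuYin2019, Thm. 1.3 and Thm. 1.4 (p. 3)] [cite: BurungaleFlach2024, Thm. 1.1 and Cor. 2] -/
theorem sylvesterTwoHeegnerIndex_bsdTwo_1113379_of_cert (hF : PublishedFactsTwo)
    (hq : ∀ (W : WeierstrassCurve ℚ) [W.IsElliptic] [W.IsGloballyMinimal],
      (∃ C : VariableChange ℚ, C • W = cubeSumCurve ((1113379 : ℕ) : ℚ)) → shaAn W = ((16 : ℚ) : ℂ))
    (hT : ∀ (W : WeierstrassCurve ℚ) [W.IsElliptic] [W.IsGloballyMinimal],
      (∃ C : VariableChange ℚ, C • W = cubeSumCurve ((1113379 : ℕ) : ℚ)) →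
        Nat.card (AddSubgroup.torsionBy W.sha (2 : ℕ)) = 16 ∧
        ∀ z : W.sha, (2 * 2) • z = 0 → 2 • z = 0)
    (W : WeierstrassCurve ℚ) [W.IsElliptic] [W.IsGloballyMinimal]
    (hW : ∃ C : VariableChange ℚ, C • W = cubeSumCurve ((1113379 : ℕ) : ℚ)) :
    BSDp W 2 :=
  bsdTwo_member_of_twoRankFour_cert hsy_1113379 hF padicValRat_two_16 hq hT W hW

/-! ### `E_{1204729}` (`p ≡ 7 (mod 9)`; conductor `9·1204729² = 13062347670969`) -/

/-- `1204729` is an 𝒞_HSY parameter: prime, `≡ 7 (mod 9)`, `3` not a cube mod it (Euler).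
[cite: HuShuYin2019, Thm. 1.4 (p. 3)] -/
theorem hsy_1204729 :
    Nat.Prime 1204729 ∧ (1204729 % 9 = 4 ∨ 1204729 % 9 = 7) ∧ ¬ ∃ x : ZMod 1204729, x ^ 3 = 3 :=
  hsy_of_pow_mod_ne_one (by norm_num) (Or.inr rfl) (by decide +kernel)

/-- **`BSD(E_{1204729}, 2)` from `PublishedFactsTwo` + DISPLAYED certificates** `hq : #Ш_an = 16`
(kit j269511: `L′(E,1) = 19.665839010…`, `∏c_v = 6`, generator from
`(13058057631/27889, 1489291812255257/4657463)`, `ĥ = 12.338336…`) and `hT` (kit j269295: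
`ellrank = [1,1,4]` ×3; `Cl(ℚ(∛(4·1204729))) ≅ [30,2,2,2]`, `bnfcertify = 1`). CONDITIONAL; EVIDENCE
consumer. [cite: Miller2011LMS, §1 and Def. 1.1] [cite: HuShuYin2019, Thm. 1.3 and Thm. 1.4 (p. 3)]
[cite: BurungaleFlach2024, Thm. 1.1 and Cor. 2] -/
theorem sylvesterTwoHeegnerIndex_bsdTwo_1204729_of_cert (hF : PublishedFactsTwo)
    (hq : ∀ (W : WeierstrassCurve ℚ) [W.IsElliptic] [W.IsGloballyMinimal],
      (∃ C : VariableChange ℚ, C • W = cubeSumCurve ((1204729 : ℕ) : ℚ)) → shaAn W = ((16 : ℚ) : ℂ))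
    (hT : ∀ (W : WeierstrassCurve ℚ) [W.IsElliptic] [W.IsGloballyMinimal],
      (∃ C : VariableChange ℚ, C • W = cubeSumCurve ((1204729 : ℕ) : ℚ)) →
        Nat.card (AddSubgroup.torsionBy W.sha (2 : ℕ)) = 16 ∧
        ∀ z : W.sha, (2 * 2) • z = 0 → 2 • z = 0)
    (W : WeierstrassCurve ℚ) [W.IsElliptic] [W.IsGloballyMinimal]
    (hW : ∃ C : VariableChange ℚ, C • W = cubeSumCurve ((1204729 : ℕ) : ℚ)) :
    BSDp W 2 :=
  bsdTwo_member_of_twoRankFour_cert hsy_1204729 hF padicValRat_two_16 hq hT W hW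

/-! ### `E_{1054327}` (`p ≡ 4 (mod 9)`; conductor `27·1054327² = 30013346419083`) -/

/-- `1054327` is an 𝒞_HSY parameter: prime, `≡ 4 (mod 9)`, `3` not a cube mod it (Euler).
[cite: HuShuYin2019, Thm. 1.4 (p. 3)] -/
theorem hsy_1054327 :
    Nat.Prime 1054327 ∧ (1054327 % 9 = 4 ∨ 1054327 % 9 = 7) ∧ ¬ ∃ x : ZMod 1054327, x ^ 3 = 3 :=
  hsy_of_pow_mod_ne_one (by norm_num) (Or.inl rfl) (by decide +kernel)

/-- **`BSD(E_{1054327}, 2)` from `PublishedFactsTwo` + DISPLAYED certificates** `hq : #Ш_an = 16`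
(kit j269511: `L′(E,1) = 15.620923117…`, `∏c_v = 3`, generator from
`(998345399281/32024281, 769689964320927893/181225406179)`, `ĥ = 18.748915…`) and `hT` (kit j269295:
`ellrank = [1,1,4]` ×3; `Cl(ℚ(∛(4·1054327))) ≅ [6,2,2,2]`, `bnfcertify = 1`, `k = 4` so THEOREM A
gives `dim Sel₂ = 5` independently). CONDITIONAL; EVIDENCE consumer. [cite: Miller2011LMS, §1 and Def. 1.1]
[cite: HuShuYin2019, Thm. 1.3 and Thm. 1.4 (p. 3)] [cite: BurungaleFlach2024, Thm. 1.1 and Cor. 2] -/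
theorem sylvesterTwoHeegnerIndex_bsdTwo_1054327_of_cert (hF : PublishedFactsTwo)
    (hq : ∀ (W : WeierstrassCurve ℚ) [W.IsElliptic] [W.IsGloballyMinimal],
      (∃ C : VariableChange ℚ, C • W = cubeSumCurve ((1054327 : ℕ) : ℚ)) → shaAn W = ((16 : ℚ) : ℂ))
    (hT : ∀ (W : WeierstrassCurve ℚ) [W.IsElliptic] [W.IsGloballyMinimal],
      (∃ C : VariableChange ℚ, C • W = cubeSumCurve ((1054327 : ℕ) : ℚ)) →
        Nat.card (AddSubgroup.torsionBy W.sha (2 : ℕ)) = 16 ∧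
        ∀ z : W.sha, (2 * 2) • z = 0 → 2 • z = 0)
    (W : WeierstrassCurve ℚ) [W.IsElliptic] [W.IsGloballyMinimal]
    (hW : ∃ C : VariableChange ℚ, C • W = cubeSumCurve ((1054327 : ℕ) : ℚ)) :
    BSDp W 2 :=
  bsdTwo_member_of_twoRankFour_cert hsy_1054327 hF padicValRat_two_16 hq hT W hW

/-! ### `E_{1062931}` (`p ≡ 4 (mod 9)`; conductor `27·1062931² = 30505202390547`; `rk₂ Cl(ℚ(∛4p)) = 5`) -/

/-- `1062931` is an 𝒞_HSY parameter: prime, `≡ 4 (mod 9)`, `3` not a cube mod it (Euler).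
[cite: HuShuYin2019, Thm. 1.4 (p. 3)] -/
theorem hsy_1062931 :
    Nat.Prime 1062931 ∧ (1062931 % 9 = 4 ∨ 1062931 % 9 = 7) ∧ ¬ ∃ x : ZMod 1062931, x ^ 3 = 3 :=
  hsy_of_pow_mod_ne_one (by norm_num) (Or.inl rfl) (by decide +kernel)

/-- **`BSD(E_{1062931}, 2)` from `PublishedFactsTwo` + DISPLAYED certificates** `hq : #Ш_an = 16`
(kit j269511: `L′(E,1) = 4.0720641922…`, `∏c_v = 3`, generator from `(1062931/25, 973644796/125)`,
`ĥ = 4.9007285…`) and `hT` (kit j269295: `ellrank = [1,1,4]` ×3; `Cl(ℚ(∛(4·1062931))) ≅ [84,2,2,2,2]`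
(`h = 1344`, `k = 5`, THEOREM A: `dim Sel₂ = k = 5`), `bnfcertify = 1`). CONDITIONAL; EVIDENCE consumer.
[cite: Miller2011LMS, §1 and Def. 1.1] [cite: HuShuYin2019, Thm. 1.3 and Thm. 1.4 (p. 3)]
[cite: BurungaleFlach2024, Thm. 1.1 and Cor. 2] -/
theorem sylvesterTwoHeegnerIndex_bsdTwo_1062931_of_cert (hF : PublishedFactsTwo)
    (hq : ∀ (W : WeierstrassCurve ℚ) [W.IsElliptic] [W.IsGloballyMinimal],
      (∃ C : VariableChange ℚ, C • W = cubeSumCurve ((1062931 : ℕ) : ℚ)) → shaAn W = ((16 : ℚ) : ℂ))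
    (hT : ∀ (W : WeierstrassCurve ℚ) [W.IsElliptic] [W.IsGloballyMinimal],
      (∃ C : VariableChange ℚ, C • W = cubeSumCurve ((1062931 : ℕ) : ℚ)) →
        Nat.card (AddSubgroup.torsionBy W.sha (2 : ℕ)) = 16 ∧
        ∀ z : W.sha, (2 * 2) • z = 0 → 2 • z = 0)
    (W : WeierstrassCurve ℚ) [W.IsElliptic] [W.IsGloballyMinimal]
    (hW : ∃ C : VariableChange ℚ, C • W = cubeSumCurve ((1062931 : ℕ) : ℚ)) :
    BSDp W 2 :=
  bsdTwo_member_of_twoRankFour_cert hsy_1062931 hF padicValRat_two_16 hq hT W hW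

/-! ### `E_{1303213}` (`p ≡ 4 (mod 9)`; conductor `27·1303213² = 45855831330963`) -/

/-- `1303213` is an 𝒞_HSY parameter: prime, `≡ 4 (mod 9)`, `3` not a cube mod it (Euler).
[cite: HuShuYin2019, Thm. 1.4 (p. 3)] -/
theorem hsy_1303213 :
    Nat.Prime 1303213 ∧ (1303213 % 9 = 4 ∨ 1303213 % 9 = 7) ∧ ¬ ∃ x : ZMod 1303213, x ^ 3 = 3 :=
  hsy_of_pow_mod_ne_one (by norm_num) (Or.inl rfl) (by decide +kernel)

/-- **`BSD(E_{1303213}, 2)` from `PublishedFactsTwo` + DISPLAYED certificates** `hq : #Ш_an = 16`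
(kit j269511: `L′(E,1) = 4.0140244390…`, `∏c_v = 3`, generator from `(1303213/49, 706341446/343)`,
`ĥ = 5.1704636…`) and `hT` (kit j269295: `ellrank = [1,1,4]` ×3; `Cl(ℚ(∛(4·1303213))) ≅ [6,2,2,2]`,
`k = 4`, `bnfcertify = 1`). CONDITIONAL; EVIDENCE consumer. [cite: Miller2011LMS, §1 and Def. 1.1]
[cite: HuShuYin2019, Thm. 1.3 and Thm. 1.4 (p. 3)] [cite: BurungaleFlach2024, Thm. 1.1 and Cor. 2] -/
theorem sylvesterTwoHeegnerIndex_bsdTwo_1303213_of_cert (hF : PublishedFactsTwo)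
    (hq : ∀ (W : WeierstrassCurve ℚ) [W.IsElliptic] [W.IsGloballyMinimal],
      (∃ C : VariableChange ℚ, C • W = cubeSumCurve ((1303213 : ℕ) : ℚ)) → shaAn W = ((16 : ℚ) : ℂ))
    (hT : ∀ (W : WeierstrassCurve ℚ) [W.IsElliptic] [W.IsGloballyMinimal],
      (∃ C : VariableChange ℚ, C • W = cubeSumCurve ((1303213 : ℕ) : ℚ)) →
        Nat.card (AddSubgroup.torsionBy W.sha (2 : ℕ)) = 16 ∧
        ∀ z : W.sha, (2 * 2) • z = 0 → 2 • z = 0)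
    (W : WeierstrassCurve ℚ) [W.IsElliptic] [W.IsGloballyMinimal]
    (hW : ∃ C : VariableChange ℚ, C • W = cubeSumCurve ((1303213 : ℕ) : ℚ)) :
    BSDp W 2 :=
  bsdTwo_member_of_twoRankFour_cert hsy_1303213 hF padicValRat_two_16 hq hT W hW

end SylvesterTwoLowerCert

end Summit.BirchSwinnertonDyer.BirchSwinnertonDyer.Theorems

end
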